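import Summits.RiemannHypothesis.RiemannHypothesis.Theorems.TiltedLandingLaw421R3Lens1ArcSignU

/-!
# W-08 · 33346 · lens-1 part V — CLUSTER CERTIFICATES: Rouché against the linearised cluster, and the twin (k = 2) producer

(lens-1 g8; ONE project import = part U `…R3Lens1ArcSignU`; namespace `RhW08.Lens1ArcSign`; 0 `sorry`; checked BY CHAIN over the tree part M with N, P, Q, S, U inlined.)
Parts S/U linearise `f^{(j+1)}/f^{(j)}` at the top `a` keeping ONE pole: `(z − a)⁻¹ + ψ`.  That is the right expansion exactly when no other zero
sits within `O(‖2/c‖)` of `a` (the isolated regime, U: 801/1 163 bank rows a priori).  In a CLUSTER (twins, triples) one keeps the `k` nearest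
poles exactly — `f^{(j+1)}/f^{(j)} = Σ_{q ∈ Q} (z − q)⁻¹ + ψ_k` — and runs Rouché against the linearised cluster numerator
`N(z) = Π(z)·(Σ_q (z − q)⁻¹ + ψ_k(a))`, a polynomial of degree `k`, around one of its roots `w₀` (a CLUSTER CHILD):

* §1 ★ `exists_crit_of_clusterCert` (abstract, k-free): `G`, `Π` differentiable, `G ≠ 0` on `B̄(w₀, r)`, `Π ≠ 0` on `B(w₀, r)`, `d ≠ 0`, and ONE circle
  inequality `‖(G′/G)(z)·Π(z) − d·(z − w₀)‖ < ‖d‖·r` on `‖z − w₀‖ = r` ⇒ a zero of `G′` in `B(w₀, r)` (Literature Rouché `existsUnique_zero_of_norm_sub_lt`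
  with `f := G′·Π` against `g := d(z − w₀)·G`).  Neither `N` nor the exactness of the root `w₀` enters: `w₀`, `d` are free row data (an approximate
  root and `d ≈ N′(w₀)` are what an instrument supplies).  `k = 1`, `M = z − a`, `d = c/2` is part Sʼs `exists_crit_near_linChild` (an unnamed `example` checks it).
* §2 the twin dictionary: with the cofactors `f^{(j)} = pairQ_a·h` (Q) and `h = pairQ_b·h₂` (tree `exists_cofactor` again, at the second zero `b`):
  `f^{(j+1)}/f^{(j)} = (z − a)⁻¹ + (z − b)⁻¹ + ψ₂`, `ψ₂ = (z − ā)⁻¹ + (z − b̄)⁻¹ + h₂′/h₂`, and `ψ₂(a) = c/2 − (a − b)⁻¹` (`psi2_apply_top`).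
* §3 `TwinCert f j a b w₀ d r S` (row-level, explicit: `b` another upper zero of `f^{(j)}`, the Rouché ball `B̄(w₀, r)` free of zeros of `f^{(j)}`,
  landing in `a`ʼs closed disc with `‖w₀ − a‖ + r < Im a`, the cofactor derivative bound `‖ψ₂′‖ ≤ S`, `h₂ ≠ 0` on `B̄(a, ‖w₀ − a‖ + r)` — quantified over
  every factorisation — and ★ the circle inequality `‖N(z) − d(z − w₀)‖ + S‖z − a‖‖(z − a)(z − b)‖ < ‖d‖ r`, `N(z) = (z − a) + (z − b) + C(z − a)(z − b)`,
  `C = c/2 − (a − b)⁻¹`) and ★★ `exists_nestedChild_of_twinCert` ⇒ a non-real child `u` with `NestedStep a u`, `‖u − w₀‖ < r`; `pinning_of_twinCert`.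

BANK READING (`linktoy/clustercert.py`, C6ʼs 1 163 rows, literal `G = e^{gz}∏(z − p)`, `Q` = `a` + the `k − 1` nearest poles, `w₀` = a root of `N`
by Durand–Kerner, `S` = 1.10 × grid max of `|ψ_k′|`, 10 cpu-s): minimal certifying `k`: ★ `k = 1`: 803 · `k = 2`: 343 · `k = 3`: 10 · `k = 4`: 5 ⇒
1 161/1 163 rows carry an A-PRIORI cluster certificate (open at `k ≤ 4`: rows 75, 932); the twin certificate alone (`linktoy/twincert.py`, nearest
pole = an upper zero in 1 100 rows, a real zero in 63): 1 138/1 163.  So on the bank the ∀-law `TopPinning` factors as: (i) a cluster of `≤ 4` poles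
isolates (regular remainder has small derivative on the interaction ball), (ii) the linearised cluster has a child landing in `D̄_a`.  (ii) for `k = 1`
is `LinkStartLawQ` (PROVED, Q); for `k ≥ 2` it is the open analogue («cluster start law»).  No law is defined here.
NOT claimed: any ∀-law, `TopPinning`.  Nothing here bears on the truth of RH; RH is not proved.
-/

noncomputable section

namespace RhW08.Lens1ArcSign

open Complex Set Metric Filter Topology
open scoped Real ComplexConjugate
open Literature.Topology.PlaneTopology Literature.Analysis.Complex
open Summit.RiemannHypothesis.RiemannHypothesis.Theorems.Splittings.JensenWindow
open RhIdea6.G17.W07C7 RhIdea6.G17.W07C7.Rev6 RhIdea6.G18.W07C8.Law421BirthS RhIdea6.G19.W07C11.Seam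
open RhIdea6.G20.W07C12.Frac RhIdea6.G20.W07C12.StColP RhW07.C12.FieldSplit RhIdea6.G21.W07C13.TentMax
open RhW07.C14.TwoSided RhW07.C14.Classes RhW07.C14.Lineage RhW07.C14.Booking
open RhW07.C13.Heredity RhIdea6.G22.W07C15pre.Injection RhW07.E3.Cell RhW07.E3.Lit
open RhW08.Round1 RhW08.StSwap RhW08.Round2 RhW08.QuadW RhW08.SealSwapQ RhW08.SealSwap RhW08.SuccB RhW08.SuccSplit
open RhW08.SuccTheft RhW08.Column RhW08.Hurwitz RhW08.ClusterQ RhW08.ClusterQM RhW08.NewtonDoor RhW08.NewtonDoorGenusOne RhW08.PurseP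
open RhW08.Lens1SignCut RhW08.Lens1Coverage RhW08.IsolatedTilt RhW08.Lens1Pinning RhW08.Lens1PinningIso

/-! ## §1 Rouché against a linearised cluster (abstract, k-free) -/

/-- ★ CLUSTER ROUCHÉ: `G`, `M` differentiable (`M` = the cluster polynomial `Π_q (z − q)` in use), `G ≠ 0` on the closed ball `B̄(w₀, r)`, `M ≠ 0` on the
open ball, `d ≠ 0`, and `‖(G′/G)(z)·M(z) − d(z − w₀)‖ < ‖d‖ r` on the circle ⇒ `G′` has a zero in `B(w₀, r)`. -/
theorem exists_crit_of_clusterCert {G M : ℂ → ℂ} (hG : Differentiable ℂ G) (hM : Differentiable ℂ M) {w₀ d : ℂ} (hd : d ≠ 0) {r : ℝ}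
    (hr : 0 < r) (hG0 : ∀ z, ‖z - w₀‖ ≤ r → G z ≠ 0) (hM0 : ∀ z, ‖z - w₀‖ < r → M z ≠ 0)
    (hsmall : ∀ z, ‖z - w₀‖ = r → ‖deriv G z / G z * M z - d * (z - w₀)‖ < ‖d‖ * r) :
    ∃ u : ℂ, ‖u - w₀‖ < r ∧ deriv G u = 0 := by
  set g : ℂ → ℂ := fun z => d * (z - w₀) * G z with hg
  have hlin : Differentiable ℂ (fun z : ℂ => d * (z - w₀)) := (differentiable_id.sub_const w₀).const_mul d
  have hgd : DifferentiableOn ℂ g (ball w₀ (r + 1)) := (hlin.mul hG).differentiableOn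
  have hfd : DifferentiableOn ℂ (fun z => deriv G z * M z) (ball w₀ (r + 1)) := ((differentiable_deriv hG).mul hM).differentiableOn
  have hR : ∀ z : ℂ, ‖z - w₀‖ = r → ‖deriv G z * M z - g z‖ < ‖g z‖ := by
    intro z hz
    have hGz : G z ≠ 0 := hG0 z hz.le
    have hgz : g z = d * (z - w₀) * G z := rfl
    have h1 : deriv G z * M z - g z = G z * (deriv G z / G z * M z - d * (z - w₀)) := by rw [hgz]; field_simp
    rw [h1, norm_mul, hgz, norm_mul, norm_mul, hz, mul_comm ‖G z‖]
    exact mul_lt_mul_of_pos_right (hsmall z hz) (norm_pos_iff.2 hGz)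
  have hw₀mem : w₀ ∈ closedBall w₀ r := mem_closedBall_self hr.le
  have hg0 : g w₀ = 0 := by show d * (w₀ - w₀) * G w₀ = 0; simp
  have hGw₀ : G w₀ ≠ 0 := hG0 w₀ (by rw [sub_self, norm_zero]; exact hr.le)
  have hg1 : deriv g w₀ ≠ 0 := by
    have hl : HasDerivAt (fun z : ℂ => d * (z - w₀)) d w₀ := by
      simpa using ((hasDerivAt_id w₀).sub_const w₀).const_mul d
    have hprod := hl.mul (hG w₀).hasDerivAt
    have hderiv : deriv g w₀ = d * G w₀ + d * (w₀ - w₀) * deriv G w₀ := hprod.deriv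
    rw [hderiv, sub_self, mul_zero, zero_mul, add_zero]
    exact mul_ne_zero hd hGw₀
  have huniq : ∀ v ∈ closedBall w₀ r, g v = 0 → v = w₀ := by
    intro v hv hgv
    have hGv : G v ≠ 0 := hG0 v (by rw [← dist_eq_norm]; exact hv)
    rcases mul_eq_zero.1 hgv with h | h
    · rcases mul_eq_zero.1 h with h' | h'
      · exact (hd h').elim
      · exact sub_eq_zero.1 h'
    · exact (hGv h).elim
  obtain ⟨u, hu, hu0, -, -⟩ :=
    Literature.Analysis.Complex.Rouche.existsUnique_zero_of_norm_sub_lt hr (by linarith) hfd hgd hR hw₀mem hg0 hg1 huniq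
  have hMu : M u ≠ 0 := hM0 u hu
  rcases mul_eq_zero.1 hu0 with h | h
  · exact ⟨u, hu, h⟩
  · exact (hMu h).elim

/-! ## §2 the twin dictionary -/

/-- At the top of a twin: `(a − ā)⁻¹ + (a − b̄)⁻¹ + h₂′/h₂(a) = c/2 − (a − b)⁻¹`, from `c = (a − Re a)⁻¹ + 2h′/h(a)` (Q) and
`h′/h(a) = (a − b)⁻¹ + ((a − b̄)⁻¹ + h₂′/h₂(a))` (part U at the zero `b` of `h`). -/
theorem psi2_apply_top {a b K K₂ c : ℂ} (ha : a.im ≠ 0) (hratio : c = (a - (a.re : ℂ))⁻¹ + (K + K))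
    (hK : K = (a - b)⁻¹ + ((a - conj b)⁻¹ + K₂)) : (a - conj a)⁻¹ + (a - conj b)⁻¹ + K₂ = c / 2 - (a - b)⁻¹ := by
  have h1 : (a - conj a)⁻¹ + K = c / 2 := psi_apply_top ha hratio
  rw [hK] at h1
  linear_combination h1

/-- `pairQ (Re v) (Im v) z ≠ 0` splits as `z ≠ v ∧ z ≠ v̄`. -/
theorem ne_and_ne_conj_of_pairQ_ne_zero {v z : ℂ} (h : pairQ v.re v.im z ≠ 0) : z ≠ v ∧ z ≠ conj v := by
  rw [pairQ_eq_mul_conj] at h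
  exact ⟨fun e => h (by rw [e, sub_self, zero_mul]), fun e => h (by rw [e, sub_self, mul_zero])⟩

/-- The algebra of the twin comparison: `(Σ poles + ψ)·Π − d(z − w₀) = (N − d(z − w₀)) + (ψ − ψ(a))·Π`. -/
theorem twin_compare_eq {z a b w₀ d P : ℂ} (Pa : ℂ) (hza : z ≠ a) (hzb : z ≠ b) :
    ((z - a)⁻¹ + (z - b)⁻¹ + P) * ((z - a) * (z - b)) - d * (z - w₀) =
      (((z - a) + (z - b) + Pa * (z - a) * (z - b)) - d * (z - w₀)) + (P - Pa) * ((z - a) * (z - b)) := by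
  have hza' : z - a ≠ 0 := sub_ne_zero.2 hza
  have hzb' : z - b ≠ 0 := sub_ne_zero.2 hzb
  field_simp
  ring

/-! ## §3 the twin certificate and its producer -/

/-- The TWIN CERTIFICATE of a top `a` with a companion zero `b` (row-level, explicit; `c := f^{(j+2)}(a)/f^{(j+1)}(a)`, `C := c/2 − (a − b)⁻¹`,
`N(z) := (z − a) + (z − b) + C(z − a)(z − b)`; `w₀`, `d`, `r`, `S` free row data — an approximate cluster child, `≈ N′(w₀)`, a radius, a bound). -/
def TwinCert (f : ℂ → ℂ) (j : ℕ) (a b w₀ d : ℂ) (r S : ℝ) : Prop :=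
  let c := iteratedDeriv (j + 2) f a / iteratedDeriv (j + 1) f a
  iteratedDeriv j f b = 0 ∧ 0 < b.im ∧ b ≠ a ∧ 0 < r ∧ d ≠ 0 ∧ ‖w₀ - a‖ + r < a.im ∧ ‖w₀ - (a.re : ℂ)‖ + r ≤ a.im ∧ r < w₀.im ∧
    (∀ z, ‖z - w₀‖ ≤ r → iteratedDeriv j f z ≠ 0) ∧
    (∀ h₂ : ℂ → ℂ, Differentiable ℂ h₂ → (∀ z, iteratedDeriv j f z = pairQ a.re a.im z * (pairQ b.re b.im z * h₂ z)) →
      ∀ z ∈ closedBall a (‖w₀ - a‖ + r), h₂ z ≠ 0 ∧ ‖deriv (fun u => (u - conj a)⁻¹ + (u - conj b)⁻¹ + deriv h₂ u / h₂ u) z‖ ≤ S) ∧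
    ∀ z, ‖z - w₀‖ = r →
      ‖((z - a) + (z - b) + (c / 2 - (a - b)⁻¹) * (z - a) * (z - b)) - d * (z - w₀)‖ + S * ‖z - a‖ * ‖(z - a) * (z - b)‖ < ‖d‖ * r

/-- ★★ TWIN CERTIFICATE ⇒ NESTED CHILD: `f` real entire of order `< 2`, `a` a SIMPLE upper zero of `f^{(j)}` with `NoTallerToucher`, and
`TwinCert f j a b w₀ d r S` ⇒ a non-real zero `u` of `f^{(j+1)}` with `NestedStep a u`, within `r` of the cluster child `w₀`. -/
theorem exists_nestedChild_of_twinCert {f : ℂ → ℂ} (hf : RealEntireLt2 f) (j : ℕ) {a : ℂ} (ha : iteratedDeriv j f a = 0) (hapos : 0 < a.im)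
    (hN : NoTallerToucher f j a) (hsimp : iteratedDeriv (j + 1) f a ≠ 0) {b w₀ d : ℂ} {r S : ℝ} (hT : TwinCert f j a b w₀ d r S) :
    ∃ u : ℂ, iteratedDeriv (j + 1) f u = 0 ∧ u.im ≠ 0 ∧ NestedStep a u ∧ ‖u - w₀‖ < r := by
  obtain ⟨hb, hbpos, hba, hr, hd, hK, hball, hup, hG0, hcof, hsmall⟩ := hT
  set c : ℂ := iteratedDeriv (j + 2) f a / iteratedDeriv (j + 1) f a with hcdef
  obtain ⟨h, hhd, hgrow, hreal, -, hfac, -, hratio⟩ := linkStart_cofactor hf j ha hapos hN hsimp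
  have hGd : Differentiable ℂ (iteratedDeriv j f) := (RhW08.WindowLoss.realEntireLt2_iteratedDeriv hf j).diff
  have hbc : b ≠ conj a := by
    intro e
    have := congrArg Complex.im e
    simp at this
    linarith
  have hhb : h b = 0 := by
    have e := hfac b
    rw [hb] at e
    rcases mul_eq_zero.1 e.symm with h0 | h0
    · exact ((pairQ_ne_zero_of_ne hba hbc) h0).elim
    · exact h0
  obtain ⟨h₂, hh₂d, -, -, hfacb⟩ := RhW08.NestedSign.exists_cofactor (G := h) ⟨hhd, hgrow, hreal⟩ hhb hbpos.ne'
  have hfac₂ : ∀ z, iteratedDeriv j f z = pairQ a.re a.im z * (pairQ b.re b.im z * h₂ z) := fun z => by rw [hfac z, hfacb z]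
  have hcof' := hcof h₂ hh₂d hfac₂
  -- the MVT ball `K = B̄(a, ‖w₀ − a‖ + r)` contains the Rouché ball and `a`, and avoids `ā`, `b̄`
  have hmemK : ∀ z, ‖z - w₀‖ ≤ r → z ∈ closedBall a (‖w₀ - a‖ + r) := by
    intro z hz
    rw [mem_closedBall, dist_eq_norm]
    calc ‖z - a‖ = ‖(z - w₀) + (w₀ - a)‖ := by ring_nf
      _ ≤ ‖z - w₀‖ + ‖w₀ - a‖ := norm_add_le _ _
      _ ≤ ‖w₀ - a‖ + r := by linarith
  have ha_mem : a ∈ closedBall a (‖w₀ - a‖ + r) := mem_closedBall_self (by positivity)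
  have hKa : ∀ z ∈ closedBall a (‖w₀ - a‖ + r), z ≠ conj a := by
    intro z hz e
    rw [mem_closedBall, dist_eq_norm, e] at hz
    have h0 : |(conj a - a).im| ≤ ‖conj a - a‖ := Complex.abs_im_le_norm _
    have h1 : (conj a - a).im = -(a.im + a.im) := by simp; ring
    rw [h1, abs_neg, abs_of_pos (by positivity)] at h0
    linarith
  have hKb : ∀ z ∈ closedBall a (‖w₀ - a‖ + r), z ≠ conj b := by
    intro z hz e
    rw [mem_closedBall, dist_eq_norm, e] at hz
    have h0 : |(conj b - a).im| ≤ ‖conj b - a‖ := Complex.abs_im_le_norm _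
    have h1 : (conj b - a).im = -(a.im + b.im) := by simp; ring
    rw [h1, abs_neg, abs_of_pos (by positivity)] at h0
    linarith
  -- the regular part `ψ₂`
  set ψ₂ : ℂ → ℂ := fun u => (u - conj a)⁻¹ + (u - conj b)⁻¹ + deriv h₂ u / h₂ u with hψdef
  have hψd : ∀ z ∈ closedBall a (‖w₀ - a‖ + r), DifferentiableAt ℂ ψ₂ z := by
    intro z hz
    have h1 : DifferentiableAt ℂ (fun u : ℂ => (u - conj a)⁻¹) z := (differentiableAt_id.sub_const (conj a)).inv (sub_ne_zero.2 (hKa z hz))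
    have h2 : DifferentiableAt ℂ (fun u : ℂ => (u - conj b)⁻¹) z := (differentiableAt_id.sub_const (conj b)).inv (sub_ne_zero.2 (hKb z hz))
    have h3 : DifferentiableAt ℂ (fun u : ℂ => deriv h₂ u / h₂ u) z := ((differentiable_deriv hh₂d) z).div (hh₂d z) (hcof' z hz).1
    exact (h1.add h2).add h3
  have hψb : ∀ z ∈ closedBall a (‖w₀ - a‖ + r), ‖deriv ψ₂ z‖ ≤ S := fun z hz => (hcof' z hz).2
  have hS0 : 0 ≤ S := le_trans (norm_nonneg _) (hψb a ha_mem)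
  have hmvt : ∀ z ∈ closedBall a (‖w₀ - a‖ + r), ‖ψ₂ z - ψ₂ a‖ ≤ S * ‖z - a‖ := fun z hz =>
    (convex_closedBall a (‖w₀ - a‖ + r)).norm_image_sub_le_of_norm_deriv_le hψd hψb ha_mem hz
  -- non-vanishing bookkeeping on the closed Rouché ball
  have hsplit : ∀ z, ‖z - w₀‖ ≤ r → (z ≠ a ∧ z ≠ conj a) ∧ (z ≠ b ∧ z ≠ conj b) ∧ h z ≠ 0 ∧ h₂ z ≠ 0 := by
    intro z hz
    have hGz := hG0 z hz
    have hz1 : pairQ a.re a.im z ≠ 0 ∧ h z ≠ 0 := mul_ne_zero_iff.1 (by rw [← hfac z]; exact hGz)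
    have hz2 : pairQ b.re b.im z ≠ 0 ∧ h₂ z ≠ 0 := mul_ne_zero_iff.1 (by rw [← hfacb z]; exact hz1.2)
    exact ⟨ne_and_ne_conj_of_pairQ_ne_zero hz1.1, ne_and_ne_conj_of_pairQ_ne_zero hz2.1, hz1.2, hz2.2⟩
  have hlog : ∀ z, ‖z - w₀‖ ≤ r →
      deriv (iteratedDeriv j f) z / iteratedDeriv j f z = (z - a)⁻¹ + (z - b)⁻¹ + ψ₂ z := by
    intro z hz
    obtain ⟨⟨hza, hzac⟩, ⟨hzb, hzbc⟩, hhz, hh₂z⟩ := hsplit z hz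
    rw [logDeriv_eq_inv_add_psi hhd hfac hza hzac hhz, logDeriv_eq_inv_add_psi hh₂d hfacb hzb hzbc hh₂z]
    simp only [hψdef]
    ring
  -- the value at the top
  have hψa : ψ₂ a = c / 2 - (a - b)⁻¹ := by
    have hab : a ≠ b := fun e => hba e.symm
    have habc : a ≠ conj b := hKb a ha_mem
    have hKf : deriv h a / h a = (a - b)⁻¹ + ((a - conj b)⁻¹ + deriv h₂ a / h₂ a) :=
      logDeriv_eq_inv_add_psi hh₂d hfacb hab habc (hcof' a ha_mem).1
    exact psi2_apply_top hapos.ne' (by rw [hcdef]; exact hratio) hKf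
  -- §1 with `Π = (z − a)(z − b)`
  have hM : Differentiable ℂ (fun z : ℂ => (z - a) * (z - b)) := (differentiable_id.sub_const a).mul (differentiable_id.sub_const b)
  have hM0 : ∀ z, ‖z - w₀‖ < r → (z - a) * (z - b) ≠ 0 := by
    intro z hz
    obtain ⟨⟨hza, -⟩, ⟨hzb, -⟩, -, -⟩ := hsplit z hz.le
    exact mul_ne_zero (sub_ne_zero.2 hza) (sub_ne_zero.2 hzb)
  have hsm : ∀ z, ‖z - w₀‖ = r →
      ‖deriv (iteratedDeriv j f) z / iteratedDeriv j f z * ((z - a) * (z - b)) - d * (z - w₀)‖ < ‖d‖ * r := by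
    intro z hz
    obtain ⟨⟨hza, -⟩, ⟨hzb, -⟩, -, -⟩ := hsplit z hz.le
    rw [hlog z hz.le, twin_compare_eq (ψ₂ a) hza hzb]
    have h2 : ‖(ψ₂ z - ψ₂ a) * ((z - a) * (z - b))‖ ≤ S * ‖z - a‖ * ‖(z - a) * (z - b)‖ := by
      rw [norm_mul]
      exact mul_le_mul_of_nonneg_right (hmvt z (hmemK z hz.le)) (norm_nonneg _)
    have h3 := hsmall z hz
    rw [← hψa] at h3
    refine lt_of_le_of_lt (norm_add_le _ _) ?_
    linarith
  obtain ⟨u, hu, hu0⟩ := exists_crit_of_clusterCert hGd hM hd hr hG0 hM0 hsm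
  have hs1 : iteratedDeriv (j + 1) f = deriv (iteratedDeriv j f) := iteratedDeriv_succ
  obtain ⟨hn, hupos⟩ := nestedStep_of_near hu hball hup
  exact ⟨u, by rw [hs1]; exact hu0, hupos.ne', hn, hu⟩

/-- Row-level producer: a twin certificate at a zero `a` of `f^{(j)}` on a legal frame gives `TopPinning`ʼs first disjunct for `a`. -/
theorem pinning_of_twinCert {η : ℝ} {f : ℂ → ℂ} {x₀ s hmax R Hs : ℝ} {B : ℕ} (hE : EngineHyps5 2 η f x₀ s hmax R Hs B) {j : ℕ} {a : ℂ}
    (ha : iteratedDeriv j f a = 0) (hapos : 0 < a.im) (hN : NoTallerToucher f j a) {b w₀ d : ℂ} {r S : ℝ} (hT : TwinCert f j a b w₀ d r S) :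
    (∃ u : ℂ, iteratedDeriv (j + 1) f u = 0 ∧ u.im ≠ 0 ∧ NestedStep a u) ∨ (∃ x : ℝ, |x - a.re| ≤ a.im ∧ NLEventOf f j x) := by
  by_cases hda : iteratedDeriv (j + 1) f a = 0
  · exact Or.inl ⟨a, hda, hapos.ne', by show (a.re - a.re) ^ 2 + a.im ^ 2 ≤ a.im ^ 2; simp⟩
  obtain ⟨u, hu, hui, hn, -⟩ := exists_nestedChild_of_twinCert (realEntireLt2_of_hyps hE) j ha hapos hN hda hT
  exact Or.inl ⟨u, hu, hui, hn⟩

-- `k = 1` is part S: `RoucheCert`ʼs hypotheses (tree `exists_crit_near_linChild`, #1212) feed §1 with `M = z − a`, `d = c/2`, `w₀ = a − 2/c`.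
-- Consistency check only — an unnamed `example`, so nothing is re-landed under a new name (desk g31 l.8529).
example {G : ℂ → ℂ} (hG : Differentiable ℂ G) {a c : ℂ} (hc : c ≠ 0) {r : ℝ} (hr : 0 < r)
    (hr2 : r < ‖2 / c‖) (hG0 : ∀ z, ‖z - (a - 2 / c)‖ ≤ r → G z ≠ 0)
    (hsmall : ∀ z, ‖z - (a - 2 / c)‖ = r → ‖(deriv G z / G z - (z - a)⁻¹ - c / 2) * (z - a)‖ < ‖c‖ / 2 * r) :
    ∃ u : ℂ, ‖u - (a - 2 / c)‖ < r ∧ deriv G u = 0 := by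
  have hc2 : c / 2 ≠ 0 := div_ne_zero hc two_ne_zero
  have hne_a : ∀ z, ‖z - (a - 2 / c)‖ ≤ r → z ≠ a := by
    intro z hz e
    rw [e, show a - (a - 2 / c) = 2 / c by ring] at hz
    linarith
  refine exists_crit_of_clusterCert (M := fun z => z - a) hG (differentiable_id.sub_const a) hc2 hr hG0
    (fun z hz => sub_ne_zero.2 (hne_a z hz.le)) ?_
  intro z hz
  have hza : z - a ≠ 0 := sub_ne_zero.2 (hne_a z hz.le)
  have e : deriv G z / G z * (z - a) - c / 2 * (z - (a - 2 / c)) = (deriv G z / G z - (z - a)⁻¹ - c / 2) * (z - a) := by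
    field_simp
    ring
  rw [e, norm_div, Complex.norm_two]
  exact hsmall z hz

end RhW08.Lens1ArcSign
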